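/-
Copyright: statement-level skeleton of a published paper (lit-balaban cell, Phase-2 proof seat p39 gen 11). No proof claims
beyond what the kernel checks below.
-/
import Literature.MathematicalPhysics.QuantumFieldTheory.Balaban1983to89.B3WT226FreeLattice

/-!
# B3 — T. Bałaban, *(Higgs)₂,₃ quantum fields in a finite volume. III. Renormalization*, CMP **88** (1983) 411–445
[Balaban1983Higgs3], (2.26) p. 431 [PDF 21]: **the Ward–Takahashi identity (2.26) WITH PERIODIC BOUNDARY CONDITIONS, at
kernel level, on the discrete torus `(ηℤ/ηNℤ)^d`** — for EVERY even kernel solving the torus lattice equation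
`(−Δ^η + M²)C = δ^η` and EVERY test function (file 1/2 of the printed route *"free boundary conditions … by taking a limit of
the identities with periodic boundary conditions"*; file 2/2 = `B3WT226PeriodicLimit`)

statement-level skeleton of published theorems with citation tags; proofs where landed; nothing here is a claim about
the Yang–Mills mass gap

PDF held: `paper:balaban1983-higgs-2-3-quantum-fields-finite-volume` (journal page = PDF page + 410); pp. 430–431 [PDF 20–21]
read on the ×2 renders `run/shared/lean/pub/pub-balaban/b2b-balaban-ref1/pages/1983-cmp88-higgs23-III/1983-cmp88-higgs23-III-p020-x2.png`,
`-p021-x2.png`.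

CITATION HEADER (lean-in-tree rule).  Part of the lit-balaban TYPED SKELETON (HOME `run/shared/lean/pub/lit-balaban/`), PHASE 2,
proof seat p39 (generation 11).  WHAT IS REPRODUCED: row **B3.Eq2.26-2.28** of `HOME/lit-balaban-r15/ROWS-B3.md` (fold owner
r15).  Companions: this seat's `B3WT226FreeLattice` (gen 11: (2.26) at FREE boundary conditions on `ηℤ^d`, proved directly;
kernels `kerCDZ`/`kerDCDZ`, terms `wt1`–`wt4`, `bracket226`) and `B3WT226Traces` (gen 3: (2.26) on the torus `T^{(j)}` of the
concrete lattice Gaussian model, by the Gaussian integration (2.23)–(2.25) of the print — the LEFT member included).  The print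
states the periodic identities on the torus `T_η` of the model; this file isolates their RIGHT member as an identity of kernels on
the abstract discrete torus `(ℤ/Nℤ)^d` with spacing `η`, which is what the limit `N → ∞` of file 2/2 consumes.

THE PRINTED TEXT (verbatim, p. 431 [PDF 21]).  *"Taking F = 1, differentiating with respect to A and next taking A = 0 and using
the identity (2.25), we get* [(2.26), the four-term identity quoted in full in `B3WT226FreeLattice`] *… Taking other functions F,
or differentiating (2.24) to higher order in A, we can get all necessary Ward-Takahashi identities. They hold for free boundary
conditions also by taking a limit of the identities with periodic boundary conditions."*

WHAT IS TYPED / PROVED (`d` arbitrary, `N ≥ 2`, torus sites `TSite d N = (ZMod N)^d`, spacing `η > 0`, `c = η⁻¹`; a bond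
`b = (x, μ)` has `b₋ = x`, `b₊ = x + e_μ`; translation-invariant kernels `C(y, z) = C(y − z)` on the torus).
* §1 the torus versions of the printed kernels and of the four printed terms of the right member of (2.26), per bond:
  `kerCDT`, `kerDCDT`, `wtT1`–`wtT4` (the `b′`-sums are FINITE sums over the torus), `bracketT = −wtT1 + wtT2 − wtT3 − wtT4` —
  literally `B3WT226FreeLattice.kerCDZ` … `bracket226` with `ℤ^d` replaced by `(ℤ/Nℤ)^d` and `Σ'` by `Σ`.
* §2 torus lattice calculus: `−Δ^η_T`, the nearest-neighbour sum, summation by parts on the finite group `(ℤ/Nℤ)^d`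
  (`sum_mul_pdiffT`, a reindexing — no convergence questions), the kernel `W_ν` and `Σ_ν∂^*_νW_ν = c²(B_μ·HC − C·HB_μ)`, the two
  lattice equations in nearest-neighbour form, the `δ`-reduction — the SAME algebra as the free file.
* §3 **`bracketT_eq_zero`** — (2.26) WITH PERIODIC BOUNDARY CONDITIONS, per bond, kernel level: for every `N ≥ 2`, every even
  `C : (ℤ/Nℤ)^d → ℝ` with `negLapT η C + M²C = η^{−d}1_{0}` (any real `M²`) and EVERY `λ : (ℤ/Nℤ)^d → ℝ`:
  `−wtT1 + wtT2 − wtT3 − wtT4 = 0`; the displayed `A`-summed form **`eq226_periodic`**.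
HONEST SCOPE: kernel-level identity only (the Gaussian left member of (2.26) on the torus is this seat's `B3WT226Traces.eq226_wick`
for the concrete model, not re-derived here); the torus propagator is ANY even solution of the torus lattice equation (file 2/2
shows that the periodization of the infinite-volume `C^η_{M²}` is one); ONE period `N ≥ 2` in all directions (so that `e_μ ≠ 0`;
the model's torus `HiggsLattice.Site` has periods `2L^{K−j}ML′_μ` per direction and is not re-identified here); (2.27)/(2.28)
(pictures) not typed.  Mathlib + the cited tree files only; definitions with bodies and theorems, no named fact, no `sorry`; standard axioms.
Unit `lit-balaban-p39-g11` (Phase-2 proof seat p39, gen 11), HOME `run/shared/lean/pub/lit-balaban/`, 2026-08-22.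
-/

open scoped BigOperators
open Finset

namespace Literature.MathematicalPhysics.QuantumFieldTheory.Balaban1983to89.B3WT226PeriodicKernel

noncomputable section

variable {d N : ℕ}

/-! ## §1 The torus `(ℤ/Nℤ)^d`, the printed kernels and the four printed terms of (2.26), per bond -/

/-- sites of the discrete torus `(ηℤ/ηNℤ)^d` in residue coordinates. [cite: Balaban1983Higgs3, (2.26) p.431] -/
abbrev TSite (d N : ℕ) : Type := Fin d → ZMod N

/-- the unit vector `e_μ` of the torus. [cite: Balaban1983Higgs3, (2.26) p.431] -/
def unitVecT (μ : Fin d) : TSite d N := Pi.single μ 1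

/-- forward difference quotient on the torus: `(∂^η_μf)(t) = c(f(t + e_μ) − f(t))`, `c = η⁻¹`. [cite: Balaban1983Higgs3, (2.26) p.431] -/
def pdiffT (c : ℝ) (μ : Fin d) (f : TSite d N → ℝ) (t : TSite d N) : ℝ := c * (f (t + unitVecT μ) - f t)

/-- the adjoint difference quotient on the torus: `(∂^{η*}_μf)(t) = c(f(t − e_μ) − f(t))` (sign convention of r15's `pdiffAdjZ`).
[cite: Balaban1983Higgs3, (2.26) p.431] -/
def pdiffAdjT (c : ℝ) (μ : Fin d) (f : TSite d N → ℝ) (t : TSite d N) : ℝ := c * (f (t - unitVecT μ) - f t)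

/-- `−Δ^η` on the torus: `(−Δ^ηf)(t) = Σ_μ η^{−2}(2f(t) − f(t + e_μ) − f(t − e_μ))`. [cite: Balaban1983Higgs3, (2.23) p.430] -/
def negLapT (η : ℝ) (f : TSite d N → ℝ) (t : TSite d N) : ℝ :=
  ∑ μ : Fin d, η⁻¹ ^ 2 * (2 * f t - f (t + unitVecT μ) - f (t - unitVecT μ))

/-- the nearest-neighbour sum `(Hf)(t) = Σ_μ(f(t + e_μ) + f(t − e_μ))` on the torus. [cite: Balaban1983Higgs3, (2.23) p.430] -/
def hopT (f : TSite d N → ℝ) (t : TSite d N) : ℝ := ∑ μ : Fin d, (f (t + unitVecT μ) + f (t - unitVecT μ))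

/-- `(C∂^{η*})(y, b) := c(C(y, b₊) − C(y, b₋))` on the torus, `b = (x, μ)` (`B3WT226FreeLattice.kerCDZ` on `(ℤ/Nℤ)^d`).
[cite: Balaban1983Higgs3, (2.26) p.431] -/
def kerCDT (c : ℝ) (C : TSite d N → ℝ) (y x : TSite d N) (μ : Fin d) : ℝ :=
  c * (C (y - (x + unitVecT μ)) - C (y - x))

/-- `(∂^ηC∂^{η*})(b′, b) := c²(C(b′₊,b₊) − C(b′₊,b₋) − C(b′₋,b₊) + C(b′₋,b₋))` on the torus (`B3WT226FreeLattice.kerDCDZ`).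
[cite: Balaban1983Higgs3, (2.26) p.431] -/
def kerDCDT (c : ℝ) (C : TSite d N → ℝ) (x' : TSite d N) (ν : Fin d) (x : TSite d N) (μ : Fin d) : ℝ :=
  c ^ 2 * (C ((x' + unitVecT ν) - (x + unitVecT μ)) - C ((x' + unitVecT ν) - x) - C (x' - (x + unitVecT μ)) + C (x' - x))

/-- first printed term of (2.26) at the bond `(x, μ)` on the torus, without the common factor `−e_kη^dA_b tr q²`: the FINITE
`b′`-sum `Σ_{b′}η^d(C∂^{η*})(b₋,b′)(C∂^{η*})(b′₋,b)(∂^ηλ)(b′)`. [cite: Balaban1983Higgs3, (2.26) p.431] -/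
def wtT1 [NeZero N] (η : ℝ) (C lam : TSite d N → ℝ) (x : TSite d N) (μ : Fin d) : ℝ :=
  ∑ x' : TSite d N, η ^ d * ∑ ν : Fin d, kerCDT η⁻¹ C x x' ν * kerCDT η⁻¹ C x' x μ * pdiffT η⁻¹ ν lam x'

/-- second printed term of (2.26) at the bond `(x, μ)` on the torus, without `+e_kη^dA_b tr q²`. [cite: Balaban1983Higgs3, (2.26) p.431] -/
def wtT2 [NeZero N] (η : ℝ) (C lam : TSite d N → ℝ) (x : TSite d N) (μ : Fin d) : ℝ :=
  ∑ x' : TSite d N, η ^ d * ∑ ν : Fin d, C (x - x') * kerDCDT η⁻¹ C x' ν x μ * pdiffT η⁻¹ ν lam x'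

/-- third printed term of (2.26) on the torus: `(∂^ηλ)(b)·C(0)`. [cite: Balaban1983Higgs3, (2.26) p.431] -/
def wtT3 (η : ℝ) (C lam : TSite d N → ℝ) (x : TSite d N) (μ : Fin d) : ℝ := pdiffT η⁻¹ μ lam x * C 0

/-- fourth printed term of (2.26) on the torus: `η(∂^ηλ)(b)·(C∂^η)(b₋, b)`. [cite: Balaban1983Higgs3, (2.26) p.431] -/
def wtT4 (η : ℝ) (C lam : TSite d N → ℝ) (x : TSite d N) (μ : Fin d) : ℝ := η * pdiffT η⁻¹ μ lam x * kerCDT η⁻¹ C x x μ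

/-- the per-bond right member of (2.26) on the torus without the common factor: `−wtT1 + wtT2 − wtT3 − wtT4`.
[cite: Balaban1983Higgs3, (2.26) p.431] -/
def bracketT [NeZero N] (η : ℝ) (C lam : TSite d N → ℝ) (x : TSite d N) (μ : Fin d) : ℝ :=
  -wtT1 η C lam x μ + wtT2 η C lam x μ - wtT3 η C lam x μ - wtT4 η C lam x μ

/-! ## §2 Torus lattice calculus -/

/-- kernel (summation by parts on the finite group `(ℤ/Nℤ)^d`): `Σ_t f(t)(∂_νg)(t) = Σ_t (∂^*_νf)(t)g(t)`. [cite: Balaban1983Higgs3, (2.26) p.431] -/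
theorem sum_mul_pdiffT [NeZero N] (f g : TSite d N → ℝ) (c : ℝ) (ν : Fin d) :
    ∑ t : TSite d N, f t * pdiffT c ν g t = ∑ t : TSite d N, pdiffAdjT c ν f t * g t := by
  have key : ∑ t : TSite d N, f t * g (t + unitVecT ν) = ∑ t : TSite d N, f (t - unitVecT ν) * g t := by
    rw [← Equiv.sum_comp (Equiv.addRight (unitVecT ν)) (fun t => f (t - unitVecT ν) * g t)]
    simp only [Equiv.coe_addRight, add_sub_cancel_right]
  simp only [pdiffT, pdiffAdjT]
  have h1 : ∑ t : TSite d N, f t * (c * (g (t + unitVecT ν) - g t)) =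
      c * ∑ t : TSite d N, f t * g (t + unitVecT ν) - c * ∑ t : TSite d N, f t * g t := by
    rw [Finset.mul_sum, Finset.mul_sum, ← Finset.sum_sub_distrib]
    exact Finset.sum_congr rfl fun t _ => by ring
  have h2 : ∑ t : TSite d N, c * (f (t - unitVecT ν) - f t) * g t =
      c * ∑ t : TSite d N, f (t - unitVecT ν) * g t - c * ∑ t : TSite d N, f t * g t := by
    rw [Finset.mul_sum, Finset.mul_sum, ← Finset.sum_sub_distrib]
    exact Finset.sum_congr rfl fun t _ => by ring
  rw [h1, h2, key]

/-- the kernel `W_ν(u) = c(C(u)B_μ(u + e_ν) − C(u + e_ν)B_μ(u))`, `B_μ = ∂^{η*}_μC`, on the torus. [cite: Balaban1983Higgs3, (2.26) p.431] -/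
def WkerT (c : ℝ) (C : TSite d N → ℝ) (μ ν : Fin d) (u : TSite d N) : ℝ :=
  c * (C u * pdiffAdjT c μ C (u + unitVecT ν) - C (u + unitVecT ν) * pdiffAdjT c μ C u)

section Algebra

variable (c : ℝ) (C lam : TSite d N → ℝ) (x : TSite d N) (μ : Fin d)

/-- kernel: `(C∂^{η*})(b₋, b′) = (∂^η_νC)(u)` for `b′ = (x + u, ν)`, `C` even. [cite: Balaban1983Higgs3, (2.26) p.431] -/
theorem kerCDT_left (hC : ∀ z, C (-z) = C z) (u : TSite d N) (ν : Fin d) :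
    kerCDT c C x (x + u) ν = pdiffT c ν C u := by
  simp only [kerCDT, pdiffT]
  rw [show x - (x + u + unitVecT ν) = -(u + unitVecT ν) by abel, show x - (x + u) = -u by abel, hC, hC]

/-- kernel: `(C∂^{η*})(b′₋, b) = (∂^{η*}_μC)(u)` for `b′₋ = x + u`. [cite: Balaban1983Higgs3, (2.26) p.431] -/
theorem kerCDT_right (u : TSite d N) : kerCDT c C (x + u) x μ = pdiffAdjT c μ C u := by
  simp only [kerCDT, pdiffAdjT]
  rw [show x + u - (x + unitVecT μ) = u - unitVecT μ by abel, show x + u - x = u by abel]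

/-- kernel: `C(b₋, b′₋) = C(u)`, `C` even. [cite: Balaban1983Higgs3, (2.26) p.431] -/
theorem C_left (hC : ∀ z, C (-z) = C z) (u : TSite d N) : C (x - (x + u)) = C u := by
  rw [show x - (x + u) = -u by abel, hC]

/-- kernel: `(∂^ηC∂^{η*})(b′, b) = (∂^η_ν∂^{η*}_μC)(u)`. [cite: Balaban1983Higgs3, (2.26) p.431] -/
theorem kerDCDT_eq (u : TSite d N) (ν : Fin d) : kerDCDT c C (x + u) ν x μ = pdiffT c ν (pdiffAdjT c μ C) u := by
  simp only [kerDCDT, pdiffT, pdiffAdjT]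
  rw [show x + u + unitVecT ν - (x + unitVecT μ) = u + unitVecT ν - unitVecT μ by abel,
    show x + u + unitVecT ν - x = u + unitVecT ν by abel, show x + u - (x + unitVecT μ) = u - unitVecT μ by abel,
    show x + u - x = u by abel]
  ring

/-- kernel: `(∂^ηλ)(b′) = (∂^η_νΛ)(u)` with `Λ = λ(x + ·)`. [cite: Balaban1983Higgs3, (2.26) p.431] -/
theorem pdiffT_shift (u : TSite d N) (ν : Fin d) :
    pdiffT c ν lam (x + u) = pdiffT c ν (fun v => lam (x + v)) u := by
  simp only [pdiffT, add_assoc]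

/-- kernel: the integrand identity `−(∂_νC)(u)B_μ(u) + C(u)(∂_νB_μ)(u) = W_ν(u)`. [cite: Balaban1983Higgs3, (2.26) p.431] -/
theorem integrand_eq_WkerT (u : TSite d N) (ν : Fin d) :
    -(pdiffT c ν C u * pdiffAdjT c μ C u) + C u * pdiffT c ν (pdiffAdjT c μ C) u = WkerT c C μ ν u := by
  simp only [WkerT, pdiffT]
  ring

/-- kernel: `−Δ^η_T f = c²(2d·f − Hf)`. [cite: Balaban1983Higgs3, (2.23) p.430] -/
theorem negLapT_eq_hopT (η : ℝ) (f : TSite d N → ℝ) (t : TSite d N) :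
    negLapT η f t = η⁻¹ ^ 2 * (2 * d * f t - hopT f t) := by
  unfold negLapT hopT
  rw [← Finset.mul_sum]
  congr 1
  have h : ∀ μ : Fin d, 2 * f t - f (t + unitVecT μ) - f (t - unitVecT μ) =
      2 * f t - (f (t + unitVecT μ) + f (t - unitVecT μ)) := fun μ => by ring
  simp_rw [h]
  rw [Finset.sum_sub_distrib, Finset.sum_const, Finset.card_univ, Fintype.card_fin, nsmul_eq_mul]
  ring

/-- kernel: the nearest-neighbour sum of `B_μ = ∂^{η*}_μC` is `c(HC(· − e_μ) − HC)`. [cite: Balaban1983Higgs3, (2.26) p.431] -/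
theorem hopT_pdiffAdjT (u : TSite d N) :
    hopT (pdiffAdjT c μ C) u = c * (hopT C (u - unitVecT μ) - hopT C u) := by
  simp only [hopT, pdiffAdjT]
  rw [← Finset.sum_sub_distrib, Finset.mul_sum]
  refine Finset.sum_congr rfl fun ν _ => ?_
  rw [show u + unitVecT ν - unitVecT μ = u - unitVecT μ + unitVecT ν by abel,
    show u - unitVecT ν - unitVecT μ = u - unitVecT μ - unitVecT ν by abel]
  ring

/-- kernel: `Σ_ν(∂^{η*}_νW_ν)(u) = c²(B_μ(u)·HC(u) − C(u)·HB_μ(u))`. [cite: Balaban1983Higgs3, (2.26) p.431] -/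
theorem sum_pdiffAdjT_WkerT (u : TSite d N) :
    ∑ ν : Fin d, pdiffAdjT c ν (WkerT c C μ ν) u =
      c ^ 2 * (pdiffAdjT c μ C u * hopT C u - C u * hopT (pdiffAdjT c μ C) u) := by
  simp only [pdiffAdjT, WkerT, hopT, sub_add_cancel]
  rw [Finset.mul_sum, Finset.mul_sum, ← Finset.sum_sub_distrib, Finset.mul_sum]
  refine Finset.sum_congr rfl fun ν _ => ?_
  ring

end Algebra

section LatticeEq

variable {η M2 : ℝ} {C : TSite d N → ℝ}

/-- kernel: the torus lattice equation in nearest-neighbour form, `c²HC = (2dc² + M²)C − δ^η`. [cite: Balaban1983Higgs3, (2.23) p.430] -/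
theorem hopT_eq_of_latticeEq (hCeq : ∀ t, negLapT η C t + M2 * C t = if t = 0 then η⁻¹ ^ d else 0) (u : TSite d N) :
    η⁻¹ ^ 2 * hopT C u = (2 * d * η⁻¹ ^ 2 + M2) * C u - (if u = 0 then η⁻¹ ^ d else 0) := by
  have h := hCeq u
  rw [negLapT_eq_hopT] at h
  linear_combination -h

/-- kernel: the lattice equation of `B_μ = ∂^{η*}_μC` in nearest-neighbour form on the torus. [cite: Balaban1983Higgs3, (2.23) p.430] -/
theorem hopT_pdiffAdjT_eq_of_latticeEq (hCeq : ∀ t, negLapT η C t + M2 * C t = if t = 0 then η⁻¹ ^ d else 0)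
    (μ : Fin d) (u : TSite d N) :
    η⁻¹ ^ 2 * hopT (pdiffAdjT η⁻¹ μ C) u = (2 * d * η⁻¹ ^ 2 + M2) * pdiffAdjT η⁻¹ μ C u -
      η⁻¹ * ((if u - unitVecT μ = 0 then η⁻¹ ^ d else 0) - (if u = 0 then η⁻¹ ^ d else 0)) := by
  rw [hopT_pdiffAdjT]
  have h1 := hopT_eq_of_latticeEq hCeq (u - unitVecT μ)
  have h2 := hopT_eq_of_latticeEq hCeq u
  simp only [pdiffAdjT]
  linear_combination η⁻¹ * h1 - η⁻¹ * h2

/-- kernel: the `δ`-reduction on the torus — only the sites `u = 0` and `u = e_μ` survive. [cite: Balaban1983Higgs3, (2.26) p.431] -/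
theorem delta_reductionT (hCeq : ∀ t, negLapT η C t + M2 * C t = if t = 0 then η⁻¹ ^ d else 0) (μ : Fin d)
    (u : TSite d N) :
    η⁻¹ ^ 2 * (pdiffAdjT η⁻¹ μ C u * hopT C u - C u * hopT (pdiffAdjT η⁻¹ μ C) u) =
      -(pdiffAdjT η⁻¹ μ C u * (if u = 0 then η⁻¹ ^ d else 0)) +
        η⁻¹ * C u * (if u - unitVecT μ = 0 then η⁻¹ ^ d else 0) - η⁻¹ * C u * (if u = 0 then η⁻¹ ^ d else 0) := by
  have h1 := hopT_eq_of_latticeEq hCeq u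
  have h2 := hopT_pdiffAdjT_eq_of_latticeEq hCeq μ u
  linear_combination pdiffAdjT η⁻¹ μ C u * h1 - C u * h2

end LatticeEq

/-! ## §3 (2.26) with periodic boundary conditions -/

section Main

variable {η M2 : ℝ} {C lam : TSite d N → ℝ}

/-- kernel: `e_μ ≠ 0` on the torus for `N ≥ 2`. [cite: Balaban1983Higgs3, (2.26) p.431] -/
theorem unitVecT_ne_zero [Fact (1 < N)] (μ : Fin d) : (unitVecT μ : TSite d N) ≠ 0 := by
  intro h
  have := congrArg (fun v : TSite d N => v μ) h
  simp [unitVecT] at this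

/-- **`−wtT1 + wtT2` in the variable `u = b′₋ − x`** on the torus (evenness of `C`). [cite: Balaban1983Higgs3, (2.26) p.431] -/
theorem neg_wtT1_add_wtT2_eq [NeZero N] (hCeven : ∀ z, C (-z) = C z) (x : TSite d N) (μ : Fin d) :
    -wtT1 η C lam x μ + wtT2 η C lam x μ =
      ∑ u : TSite d N, η ^ d * ∑ ν : Fin d, WkerT η⁻¹ C μ ν u * pdiffT η⁻¹ ν (fun v => lam (x + v)) u := by
  have h1 : wtT1 η C lam x μ = ∑ u : TSite d N, η ^ d * ∑ ν : Fin d,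
      pdiffT η⁻¹ ν C u * pdiffAdjT η⁻¹ μ C u * pdiffT η⁻¹ ν (fun v => lam (x + v)) u := by
    rw [wtT1, ← Equiv.sum_comp (Equiv.addLeft x)]
    refine Finset.sum_congr rfl fun u _ => ?_
    simp only [Equiv.coe_addLeft]
    congr 1
    refine Finset.sum_congr rfl fun ν _ => ?_
    rw [kerCDT_left η⁻¹ C x hCeven, kerCDT_right, pdiffT_shift]
  have h2 : wtT2 η C lam x μ = ∑ u : TSite d N, η ^ d * ∑ ν : Fin d,
      C u * pdiffT η⁻¹ ν (pdiffAdjT η⁻¹ μ C) u * pdiffT η⁻¹ ν (fun v => lam (x + v)) u := by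
    rw [wtT2, ← Equiv.sum_comp (Equiv.addLeft x)]
    refine Finset.sum_congr rfl fun u _ => ?_
    simp only [Equiv.coe_addLeft]
    congr 1
    refine Finset.sum_congr rfl fun ν _ => ?_
    rw [C_left C x hCeven, kerDCDT_eq, pdiffT_shift]
  rw [h1, h2, ← Finset.sum_neg_distrib, ← Finset.sum_add_distrib]
  refine Finset.sum_congr rfl fun u _ => ?_
  rw [← mul_neg, ← mul_add, ← Finset.sum_neg_distrib, ← Finset.sum_add_distrib]
  congr 1
  refine Finset.sum_congr rfl fun ν _ => ?_
  rw [← integrand_eq_WkerT]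
  ring

/-- **the value of `−wtT1 + wtT2` on the torus**: `= C(e_μ)·(∂^η_μλ)(x)` (finite summation by parts, `Σ_ν∂^*_νW_ν`, the two
lattice equations, the `δ`-reduction). [cite: Balaban1983Higgs3, (2.26) p.431] -/
theorem neg_wtT1_add_wtT2_eq_local [NeZero N] [Fact (1 < N)] (hη : 0 < η) (hCeven : ∀ z, C (-z) = C z)
    (hCeq : ∀ t, negLapT η C t + M2 * C t = if t = 0 then η⁻¹ ^ d else 0) (x : TSite d N) (μ : Fin d) :
    -wtT1 η C lam x μ + wtT2 η C lam x μ = C (unitVecT μ) * pdiffT η⁻¹ μ lam x := by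
  have hη0 : η ≠ 0 := hη.ne'
  set Λ : TSite d N → ℝ := fun v => lam (x + v) with hΛ
  rw [neg_wtT1_add_wtT2_eq hCeven x μ]
  -- Step 1: finite summation by parts in each direction
  have step1 : ∑ u : TSite d N, η ^ d * ∑ ν : Fin d, WkerT η⁻¹ C μ ν u * pdiffT η⁻¹ ν Λ u =
      ∑ u : TSite d N, (∑ ν : Fin d, pdiffAdjT η⁻¹ ν (fun v => η ^ d * WkerT η⁻¹ C μ ν v) u) * Λ u := by
    calc ∑ u : TSite d N, η ^ d * ∑ ν : Fin d, WkerT η⁻¹ C μ ν u * pdiffT η⁻¹ ν Λ u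
        = ∑ u : TSite d N, ∑ ν : Fin d, (η ^ d * WkerT η⁻¹ C μ ν u) * pdiffT η⁻¹ ν Λ u := by
          refine Finset.sum_congr rfl fun u _ => ?_
          rw [Finset.mul_sum]
          exact Finset.sum_congr rfl fun ν _ => by ring
      _ = ∑ ν : Fin d, ∑ u : TSite d N, (η ^ d * WkerT η⁻¹ C μ ν u) * pdiffT η⁻¹ ν Λ u := Finset.sum_comm
      _ = ∑ ν : Fin d, ∑ u : TSite d N, pdiffAdjT η⁻¹ ν (fun v => η ^ d * WkerT η⁻¹ C μ ν v) u * Λ u := by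
          refine Finset.sum_congr rfl fun ν _ => ?_
          exact sum_mul_pdiffT _ Λ η⁻¹ ν
      _ = ∑ u : TSite d N, ∑ ν : Fin d, pdiffAdjT η⁻¹ ν (fun v => η ^ d * WkerT η⁻¹ C μ ν v) u * Λ u := Finset.sum_comm
      _ = ∑ u : TSite d N, (∑ ν : Fin d, pdiffAdjT η⁻¹ ν (fun v => η ^ d * WkerT η⁻¹ C μ ν v) u) * Λ u :=
          Finset.sum_congr rfl fun u _ => by rw [Finset.sum_mul]
  rw [step1]
  -- Step 2: the pointwise δ-reduction
  have step2 : ∀ u, (∑ ν : Fin d, pdiffAdjT η⁻¹ ν (fun v => η ^ d * WkerT η⁻¹ C μ ν v) u) * Λ u =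
      (if u = 0 then -(pdiffAdjT η⁻¹ μ C 0) * Λ 0 - η⁻¹ * C 0 * Λ 0 else 0) +
        (if u = unitVecT μ then η⁻¹ * C (unitVecT μ) * Λ (unitVecT μ) else 0) := by
    intro u
    have hlin : ∑ ν : Fin d, pdiffAdjT η⁻¹ ν (fun v => η ^ d * WkerT η⁻¹ C μ ν v) u =
        η ^ d * ∑ ν : Fin d, pdiffAdjT η⁻¹ ν (WkerT η⁻¹ C μ ν) u := by
      rw [Finset.mul_sum]
      refine Finset.sum_congr rfl fun ν _ => ?_
      simp only [pdiffAdjT]; ring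
    rw [hlin, sum_pdiffAdjT_WkerT, delta_reductionT hCeq μ u]
    have hpow : η ^ d * η⁻¹ ^ d = 1 := by rw [← mul_pow, mul_inv_cancel₀ hη0, one_pow]
    by_cases hu0 : u = 0
    · subst hu0
      have hne : (0 : TSite d N) - unitVecT μ ≠ 0 := by
        rw [zero_sub, neg_ne_zero]; exact unitVecT_ne_zero μ
      have hne' : (0 : TSite d N) ≠ unitVecT μ := fun h => unitVecT_ne_zero μ h.symm
      simp only [if_true, if_neg hne, if_neg hne', mul_zero, add_zero]
      linear_combination (-(pdiffAdjT η⁻¹ μ C 0) * Λ 0 - η⁻¹ * C 0 * Λ 0) * hpow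
    · by_cases hu1 : u = unitVecT μ
      · subst hu1
        simp only [if_neg hu0, sub_self, if_true, mul_zero, neg_zero, zero_add, sub_zero]
        linear_combination (η⁻¹ * C (unitVecT μ) * Λ (unitVecT μ)) * hpow
      · have hne : u - unitVecT μ ≠ 0 := fun h => hu1 (sub_eq_zero.mp h)
        simp only [if_neg hu0, if_neg hu1, if_neg hne, mul_zero, neg_zero, add_zero, sub_zero, zero_mul]
  rw [Finset.sum_congr rfl fun u _ => step2 u, Finset.sum_add_distrib, Finset.sum_ite_eq' Finset.univ (0 : TSite d N),
    Finset.sum_ite_eq' Finset.univ (unitVecT μ : TSite d N)]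
  simp only [Finset.mem_univ, if_true]
  -- Step 3: the local terms
  simp only [hΛ, pdiffAdjT, pdiffT, add_zero, zero_sub, hCeven]
  ring

/-- **`wtT3 + wtT4 = C(e_μ)·(∂^η_μλ)(x)`** on the torus. [cite: Balaban1983Higgs3, (2.26) p.431] -/
theorem wtT3_add_wtT4_eq (hη : 0 < η) (hCeven : ∀ z, C (-z) = C z) (x : TSite d N) (μ : Fin d) :
    wtT3 η C lam x μ + wtT4 η C lam x μ = C (unitVecT μ) * pdiffT η⁻¹ μ lam x := by
  have hη0 : η ≠ 0 := hη.ne'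
  simp only [wtT3, wtT4, kerCDT]
  rw [show x - (x + unitVecT μ) = -unitVecT μ by abel, sub_self, hCeven]
  field_simp
  ring

/-- **(2.26) WITH PERIODIC BOUNDARY CONDITIONS, per bond, kernel level** — on the discrete torus `(ηℤ/ηNℤ)^d`, `N ≥ 2`: for
every even kernel `C` solving `(−Δ^η + M²)C = δ^η` and every test function `λ`, the four printed terms of the right member
of (2.26) at the bond `(x, μ)` satisfy `−wtT1 + wtT2 − wtT3 − wtT4 = 0`. [cite: Balaban1983Higgs3, (2.26) p.431] -/
theorem bracketT_eq_zero [NeZero N] [Fact (1 < N)] (hη : 0 < η) (hCeven : ∀ z, C (-z) = C z)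
    (hCeq : ∀ t, negLapT η C t + M2 * C t = if t = 0 then η⁻¹ ^ d else 0) (x : TSite d N) (μ : Fin d) :
    bracketT η C lam x μ = 0 := by
  have h1 := neg_wtT1_add_wtT2_eq_local (lam := lam) hη hCeven hCeq x μ
  have h2 := wtT3_add_wtT4_eq (lam := lam) hη hCeven x μ
  unfold bracketT
  linear_combination h1 - h2

/-- **(2.26) WITH PERIODIC BOUNDARY CONDITIONS, as displayed** — summed against an external vector leg `A_b` on the torus
with the printed factors `−e_k`, `η^d`, `τ = tr q²`. [cite: Balaban1983Higgs3, (2.26) p.431] -/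
theorem eq226_periodic [NeZero N] [Fact (1 < N)] (hη : 0 < η) (hCeven : ∀ z, C (-z) = C z)
    (hCeq : ∀ t, negLapT η C t + M2 * C t = if t = 0 then η⁻¹ ^ d else 0)
    (e τ : ℝ) (Aleg : TSite d N → Fin d → ℝ) :
    (-e * ∑ x : TSite d N, ∑ μ : Fin d, η ^ d * Aleg x μ * (τ * wtT1 η C lam x μ)) +
      (e * ∑ x : TSite d N, ∑ μ : Fin d, η ^ d * Aleg x μ * (τ * wtT2 η C lam x μ)) -
      (e * ∑ x : TSite d N, ∑ μ : Fin d, η ^ d * Aleg x μ * (τ * wtT3 η C lam x μ)) -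
      (e * ∑ x : TSite d N, ∑ μ : Fin d, η ^ d * Aleg x μ * (τ * wtT4 η C lam x μ)) = 0 := by
  have key : ∀ x μ, -wtT1 η C lam x μ + wtT2 η C lam x μ - wtT3 η C lam x μ - wtT4 η C lam x μ = 0 :=
    fun x μ => bracketT_eq_zero hη hCeven hCeq x μ
  calc (-e * ∑ x : TSite d N, ∑ μ : Fin d, η ^ d * Aleg x μ * (τ * wtT1 η C lam x μ)) +
      (e * ∑ x : TSite d N, ∑ μ : Fin d, η ^ d * Aleg x μ * (τ * wtT2 η C lam x μ)) -
      (e * ∑ x : TSite d N, ∑ μ : Fin d, η ^ d * Aleg x μ * (τ * wtT3 η C lam x μ)) -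
      (e * ∑ x : TSite d N, ∑ μ : Fin d, η ^ d * Aleg x μ * (τ * wtT4 η C lam x μ))
      = e * τ * ∑ x : TSite d N, ∑ μ : Fin d, η ^ d * Aleg x μ *
          (-wtT1 η C lam x μ + wtT2 η C lam x μ - wtT3 η C lam x μ - wtT4 η C lam x μ) := by
        simp only [Finset.mul_sum, ← Finset.sum_add_distrib, ← Finset.sum_sub_distrib]
        refine Finset.sum_congr rfl fun x _ => Finset.sum_congr rfl fun μ _ => ?_
        ring
    _ = 0 := by simp only [key, mul_zero, Finset.sum_const_zero]

end Main

end

end Literature.MathematicalPhysics.QuantumFieldTheory.Balaban1983to89.B3WT226PeriodicKernel
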